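import Summits.CriticalPhenomena.PercolationContinuityZ3.Theorems.PercShatteringRaceNearLinearTwoClusterDecayCritFrontier
import Summits.CriticalPhenomena.PercolationContinuityZ3.Theorems.PercShatteringRaceNearLinearTwoClusterDecayStubCritTwoArmImproved
import HarnessLib

/-!
# Crux `PercShatteringRace.NearLinearTwoClusterDecay` (stmt-CriticalPhenomena-5785) — certificate U₁, sequel:
# the threshold exponent is STRICTLY below `48` (bond Cerf 2015 Theorem 1.1 at `p_c`, unconditional)

Helper file of the line `pair-decay-long-arms-dense` (lead c6); lands with `--supports stmt-CriticalPhenomena-5785`.  Sequel of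
`…CritFrontier.lean` (`critAtExponent_of_gt_48`: `Negative.AtExponent A` for every `A > 48`, no world hypothesis), adding the landed
frontier stub W2 `Theorems.stub_critTwoArmImproved` (`∃ κ > 1/2, P_{p_c}(edgeTwoArms i m) ≤ C m^{-κ}`: the AKN two-arms exponent `1/2`
is NOT sharp at `p_c(ℤ³)` for bond percolation — Cerf's §8–§9 dyadic iteration re-run with the unconditional two-point input W1):

* `exists_critAtExponent_lt_48` — `∃ A < 48, AtExponent A` (W3 at the improved `κ`);
* `critAtExponent_of_ge_48` — the endpoint: `AtExponent A` for every `A ≥ 48` (monotonicity `Negative.atExponent_mono`);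
* `atExponent_status'` — decay fails at every `A ≤ 1`, holds at every `A ≥ 48` and at some `A < 48`; the crux is `A = 7/6`.

## References

* R. Cerf, Ann. Probab. 43 (2015) 2458–2480, arXiv:1306.3105: Thm 1.1 (two-arms exponent `> 1/2`), Thm 1.2 [Cerf2015].
-/

noncomputable section

namespace Summit.CriticalPhenomena.PercolationContinuityZ3.Theorems

namespace NearLinearTwoClusterDecay.CritFrontier

open MeasureTheory Filter Topology
open Literature.Probability.LatticeModels Literature.Probability.Percolation
open Summit.CriticalPhenomena.PercolationContinuityZ3.Theorems.NearLinearTwoClusterDecay.Negative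

/-- **The threshold exponent is strictly below `48`**: there is `A < 48` with `AtExponent A` — W3 at the improved two-arms
exponent `κ > 1/2` of W2 (`A = (24/κ + 48)/2`). [cite: Cerf2015, Thm 1.1 and Thm 1.2] -/
theorem exists_critAtExponent_lt_48 : ∃ A : ℝ, A < 48 ∧ NearLinearTwoClusterDecay.Negative.AtExponent A := by
  obtain ⟨κ, hκ, hT⟩ := stub_critTwoArmImproved stub_critPairConnLower
  have hκ0 : 0 < κ := by linarith
  have h24 : 24 / κ < 48 := by rw [div_lt_iff₀ hκ0]; linarith
  have h0 : 0 < 24 / κ := by positivity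
  refine ⟨(24 / κ + 48) / 2, by linarith, ?_⟩
  refine stub_critAspectOfTwoArm stub_critPairConnLower κ hκ0 hT _ (by linarith) ?_
  have : κ * ((24 / κ + 48) / 2) = 12 + 24 * κ := by field_simp; ring
  rw [this]; linarith

/-- **`AtExponent A` for every `A ≥ 48`, unconditionally** (the endpoint, by monotonicity from some `A' < 48`; `A' > 1` since
decay fails at every exponent `≤ 1`). [cite: Cerf2015, Thm 1.2] -/
theorem critAtExponent_of_ge_48 {A : ℝ} (hA : 48 ≤ A) : AtExponent A := by
  obtain ⟨A', hA', h⟩ := exists_critAtExponent_lt_48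
  by_cases h1 : 1 ≤ A'
  · exact atExponent_mono h1 (by linarith) h
  · exact absurd h (not_atExponent_of_le_one (by push Not at h1; linarith))

/-- **Status line of the crux family** (for the planner): decay FAILS at every exponent `≤ 1`, HOLDS at every exponent `≥ 48`
and at some exponent `< 48`, unconditionally; the crux is the instance `7/6`. [folklore] -/
theorem atExponent_status' :
    (∀ A : ℝ, A ≤ 1 → ¬ AtExponent A) ∧ (∀ A : ℝ, 48 ≤ A → AtExponent A) ∧ (∃ A : ℝ, A < 48 ∧ AtExponent A) ∧
    (Theses.PercShatteringRace.NearLinearTwoClusterDecay ↔ AtExponent ((7 : ℝ) / 6)) :=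
  ⟨fun _ hA => not_atExponent_of_le_one hA, fun _ hA => critAtExponent_of_ge_48 hA, exists_critAtExponent_lt_48,
    nearLinearTwoClusterDecay_iff⟩

end NearLinearTwoClusterDecay.CritFrontier

end Summit.CriticalPhenomena.PercolationContinuityZ3.Theorems

end
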